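import Summits.ABC.ABC.Theorems.IUTThetaPilotABCOfThetaPartII
import Summits.ABC.ABC.Theses.CubicResolventAllowance
import Summits.ABC.StrongHypotheses
import Literature.NumberTheory.EllipticCurves.SzpiroOfAbcProofs
import HarnessLib

/-!
# Stub-ideation k=1 (FAMILY 1 — RECOGNISE & IMPORT), gen 27 — `stub_complexCubic` of crux `IndexSzpiro`
# (stmt-ABC-22740, route `CubicResolventAllowance`): the ANABELIAN-SCHOOL TREE MATCH, by name.

Companion of `STUB-IDEAS-stub_complexCubic-1.md` (gen 27).  Gens 2–26 of this slot stand by reference.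

The one school in which the stub's SHAPE — Szpiro `6(1+ε)` with a FIELD-DISCRIMINANT (log-different)
ALLOWANCE that is absorbed afterwards by Néron–Ogg–Shafarevich — is the native output is inter-universal
Teichmüller theory: [IUTchIV] Thm 1.10 displays `(1/6)·log q ≤ (1+ε)·(log-diff + log-cond) + C`
(tree: `Literature.IUT.LogVolume.Cor22.DisplayWith`, `…Thm110LegendreWith`, record interface
`…Cor22.Thm110Legendre`; status `[claim: Mochizuki2012, status: disputed]`, barrier file
`Literature/Barriers/ABC/IUTDisputedClaim.lean`).  The tree already proves
`Summit.ABC.ABC.Theorems.ABC_of_thm110Legendre` and `…ABC_of_thetaPartII` (route `IUTThetaPilot`, whose only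
open item is the crux `ThetaPartII` = stmt-ABC-19678).  This file records the resulting DOMINATION EDGES by
name (calibration only — the direction is the benign one; nothing here is progress on the stub, on Szpiro or
on abc, and no side is taken on [IUTchIII] Cor. 3.12):

* `indexSzpiro_of_thetaPartII  : IUTThetaPilot.ThetaPartII → IndexSzpiro`   (stmt-ABC-19678 ⟹ stmt-ABC-22740)
* `stubComplexCubic_of_thetaPartII`, `stubComplexCubic_of_thm110Legendre`     (⟹ the registered stub)

Read at the class point itself (λ ∈ P¹∖{0,1,∞} of degree 6 over ℚ, `F_tpd ⊆ ℚ(E[2]) ⊇ K`), the display nets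
the allowance to zero: a multiplicative prime `p ≥ 5` with odd tower is tamely ramified in `L = ℚ(E[2])` with
`e = 2`, contributing `(1/6)·3·log p = ½·log p` to `log-diff_L` and `½·log p` to `log-cond_L`, total `log p`
— exactly what an unramified (even-tower) prime contributes; so Thm 1.10 AT the class point is class Szpiro
`6(1+ε')` with NO `d_K`-allowance (the same zero-net bookkeeping as Vojta's Prop. 31.2, k1 g26), and the stub's
`|d_K|¹` is reached from this school only THROUGH abc (`d = 1` after the [GenEll]/Belyi descent), never by a
bounded-degree reading.  No `sorry`.
-/

set_option linter.dupNamespace false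

noncomputable section

namespace Summit.ABC.ABC.Cruxes.IndexSzpiro.StubIdeas1G27

open Summit.ABC.ABC.Theses.CubicResolventAllowance
open Literature.NumberTheory.EllipticCurves Literature.NumberTheory.DiophantineGeometry
open Literature.Abc

/-! ## §0 The registered stub, verbatim -/

/-- `stub_complexCubic` (the `d_K < 0` half of `IndexSzpiro`), verbatim registered signature
(skeleton sha d34fb8f2…). -/
def StubComplexCubic : Prop :=
  ∀ ε : ℝ, 0 < ε → ∃ C : ℝ, ∀ (W : WeierstrassCurve ℚ) [W.IsElliptic] (K : Type) [Field K]
    [NumberField K], Irreducible W.twoTorsionPolynomial.toPoly → Module.finrank ℚ K = 3 →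
    (∃ θ : K, Polynomial.aeval θ W.twoTorsionPolynomial.toPoly = 0) → NumberField.discr K < 0 →
    (W.minimalDiscriminantNorm ℤ : ℝ) ≤
      C * |(NumberField.discr K : ℝ)| * (W.conductorNorm ℤ : ℝ) ^ (6 + ε)

/-- `1 ≤ |d_K|` as reals (k1-real G4, re-proved so that this file imports tree modules only). -/
theorem one_le_abs_discr (K : Type) [Field K] [NumberField K] :
    (1 : ℝ) ≤ |(NumberField.discr K : ℝ)| := by
  have h1 : (1 : ℤ) ≤ |NumberField.discr K| := Int.one_le_abs (NumberField.discr_ne_zero K)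
  have h2 : ((1 : ℤ) : ℝ) ≤ ((|NumberField.discr K| : ℤ) : ℝ) := by exact_mod_cast h1
  simpa [Int.cast_abs] using h2

/-- `SzpiroConjecture → IndexSzpiro` (k1 G6 / k1-real G4 `indexSzpiro_of_szpiro`, re-proved; `K` enters only
through `1 ≤ |d_K|`). Calibration. -/
theorem indexSzpiro_of_szpiro (h : SzpiroConjecture) : IndexSzpiro := by
  intro ε hε
  obtain ⟨C, hC⟩ := h ε hε
  refine ⟨max C 0, ?_⟩
  intro W _ K _ _ _ _ _
  have h1 := hC W
  have hd := one_le_abs_discr K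
  have hrpow : (0 : ℝ) ≤ (W.conductorNorm ℤ : ℝ) ^ (6 + ε) := Real.rpow_nonneg (Nat.cast_nonneg _) _
  calc (W.minimalDiscriminantNorm ℤ : ℝ) ≤ C * (W.conductorNorm ℤ : ℝ) ^ (6 + ε) := h1
    _ ≤ max C 0 * (W.conductorNorm ℤ : ℝ) ^ (6 + ε) := mul_le_mul_of_nonneg_right (le_max_left _ _) hrpow
    _ = max C 0 * 1 * (W.conductorNorm ℤ : ℝ) ^ (6 + ε) := by ring
    _ ≤ max C 0 * |(NumberField.discr K : ℝ)| * (W.conductorNorm ℤ : ℝ) ^ (6 + ε) :=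
        mul_le_mul_of_nonneg_right (mul_le_mul_of_nonneg_left hd (le_max_right _ _)) hrpow

/-- `ABC → IndexSzpiro` (tree `szpiro_of_abcLe_holds` = Silverman VIII.11.5(b), via the `≤`-form
`Summit.ABC.StrongHypotheses.abc_iff_abcLe`; k1-real G4 `indexSzpiro_of_abc`, re-proved). Calibration. -/
theorem indexSzpiro_of_abc (h : _root_.ABC) : IndexSzpiro :=
  indexSzpiro_of_szpiro (szpiro_of_abcLe_holds (Summit.ABC.StrongHypotheses.abc_iff_abcLe.mp h))

/-- **H0 (S, PROVED).** The crux gives its complex half (the sign hypothesis is simply dropped). -/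
theorem stubComplexCubic_of_indexSzpiro (h : IndexSzpiro) : StubComplexCubic := by
  intro ε hε
  obtain ⟨C, hC⟩ := h ε hε
  exact ⟨C, fun W _ K _ _ hirr hdeg hθ _ => hC W K hirr hdeg hθ⟩

/-! ## §1 The anabelian-school domination edges, by name -/

/-- **H1 (S, PROVED; cross-route edge stmt-ABC-19678 ⟹ stmt-ABC-22740).** The open crux of route
`IUTThetaPilot` ([IUTchIV] Cor. 2.2 (ii), uniform; rests on the DISPUTED [IUTchIII] Cor. 3.12) implies the
crux `IndexSzpiro`, through `ABC_of_thetaPartII` (tree) and Silverman VIII.11.5(b) (tree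
`szpiro_of_abcLe_holds`, packaged as `indexSzpiro_of_abc`, k1-real G4).  Calibration; asserts nothing about
either crux. [claim: Mochizuki2012, status: disputed] -/
theorem indexSzpiro_of_thetaPartII (h : Summit.ABC.ABC.Theses.IUTThetaPilot.ThetaPartII) : IndexSzpiro :=
  indexSzpiro_of_abc (Summit.ABC.ABC.Theorems.ABC_of_thetaPartII h)

/-- **H2 (S, PROVED).** `ThetaPartII → stub_complexCubic`. [claim: Mochizuki2012, status: disputed] -/
theorem stubComplexCubic_of_thetaPartII (h : Summit.ABC.ABC.Theses.IUTThetaPilot.ThetaPartII) :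
    StubComplexCubic :=
  stubComplexCubic_of_indexSzpiro (indexSzpiro_of_thetaPartII h)

/-- **H3 (S, PROVED).** The ONE named interface of the disputed chain — the Thm 1.10 display with its
`(1+20·d_mod/l)·(log-diff + log-cond)` allowance, `Cor22.Thm110Legendre` — implies the stub (via
`ABC_of_thm110Legendre`, tree).  This is the in-tree form of "the stub's shape is native to [IUTchIV] Thm 1.10";
the implication runs THROUGH abc, i.e. through the `d = 1` descent, not through a degree-6 reading at the
class point (see the module docstring). [claim: Mochizuki2012, status: disputed] -/
theorem stubComplexCubic_of_thm110Legendre (h : Literature.IUT.LogVolume.Cor22.Thm110Legendre) :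
    StubComplexCubic :=
  stubComplexCubic_of_indexSzpiro (indexSzpiro_of_abc (Summit.ABC.ABC.Theorems.ABC_of_thm110Legendre h))

/-! ## §2 The zero-net bookkeeping at the class point, as arithmetic (the tame `e = 2` line) -/

/-- **H4 (S, PROVED; pure arithmetic).** In a degree-6 field, a prime with ramification index `2` at every
prime above it (so `Σ f = 3`) has different-exponent `1` at each, hence `v_p(d_L) = 3`, and the normalised
contributions `(1/6)·v_p(d_L)·log p` (log-diff) and `(1/6)·(Σ f)·log p` (log-cond) sum to `log p` — the
contribution of an unramified multiplicative prime.  Stated as the bare identity it is. -/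
theorem tame_two_net_zero (logp : ℝ) : (1 / 6 : ℝ) * 3 * logp + (1 / 6 : ℝ) * 3 * logp = logp := by ring

end Summit.ABC.ABC.Cruxes.IndexSzpiro.StubIdeas1G27
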